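import Literature.NumberTheory.DiophantineGeometry.AVIsogenyTateFinrankHomCubeProofs
import HarnessLib

/-!
# `Hom(A, B)` finitely generated (Mumford §19, Theorem 3): the trust base reduced to the theorem of
# the cube, Poincaré reducibility and "simple ⇒ isogeny"

Sixth part of the proof files for the named fact
`Literature.AlgebraicGeometry.Motives.AbelianVariety.module_finite_hom` of `AVIsogenyTate`
(`Hom(A, B)` is finitely generated; Mumford, *Abelian Varieties*, §19, Theorem 3; Milne 1986,
Theorem 12.5).

`AVIsogenyTateHomDegBoundProofs` assembles Theorem 3 from: Poincaré's complete reducibility theorem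
(§19 Thm. 1), "non-zero homomorphisms between simple abelian varieties are isogenies" (§19 Cor. 2
of Thm. 1), a degree *bound* `deg (∑ nᵢ eᵢ) ≤ C_e (∑ |nᵢ|)^{2 dim X}` on simple `X` (the part of
§19 Thm. 2 that is used), and the named facts `isIsogeny_zsmul_id`, `kerRank_zsmul_id`,
`natCard_torsionPoints_of_isAlgClosed` (§6 App. 2–3). `Motives/AbelianVarietyEndDegreeBound` now
**proves** the degree bound from the theorem of the cube (`kerRank_sum_le_of_theoremOfCube`), and
the three named facts are consequences of the theorem of the cube already in the tree
(`isIsogeny_zsmul_id_of_theoremOfCube_linEquiv`, `kerRank_zsmul_id_of_theoremOfCube_linEquiv`,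
`natCard_torsionPoints_of_isAlgClosed_of_theoremOfCube_linEquiv`), and
`AVIsogenyTateFinrankHomCubeProofs` assembles accordingly
`AbelianVariety.module_finite_hom_of_theoremOfCube_of_poincare`: Mumford §19 Thm. 3 for all `A`, `B`
over `K` from the Theorem of the Cube (Görtz–Wedhorn II, Thm. 24.73, the named fact
`theoremOfCube_linEquiv`), Poincaré's complete reducibility theorem (§19 Thm. 1, hypothesis `hP1`)
and "simple ⇒ isogeny" (§19 Cor. 2 of Thm. 1, hypothesis `hsimple`), both over `K`. Here:

* `AbelianVariety.module_finite_hom_of_theoremOfCube_of_algebraicClosure` — the same with the two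
  geometric hypotheses required only over the algebraic closure `K̄` (where they are classically
  stated and proved: Mumford works over `k = k̄` throughout), by the faithfulness of base change on
  `Hom` (`module_finite_hom_of_baseChange`, `AVIsogenyTateHomProofs`; Milne 1986, Thm. 12.5 is
  stated over an arbitrary field). This is the form in which proofs of `hP1` and `hsimple` over
  algebraically closed fields will discharge the named fact `module_finite_hom`.

So the named fact `module_finite_hom` now rests on exactly: the theorem of the cube (coherent
cohomology and base change), Poincaré reducibility (§19 Thm. 1: duals / `Pic⁰`, or Mumford §8
Thm. 1) and §19 Cor. 2 of Thm. 1 (images and identity components of kernels of homomorphisms as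
abelian subvarieties) — the last two over `K̄` only.

## References

* [MumfordAV1970] D. Mumford, *Abelian Varieties*, §19, Thm. 1 with Cor. 1–2 (pp. 173–174 of the
  2nd ed.), Thm. 2 (p. 174), Thm. 3 and its proof (pp. 176–178); §6 App. 2–3 (p. 64), Cor. 2
  (p. 58). Not held; architecture as in Milne 1986.
* [Milne1986AbelianVarieties] J. S. Milne, *Abelian Varieties*, in Cornell–Silverman (eds.),
  *Arithmetic Geometry*, Springer 1986, §12, Prop. 12.1, Prop. 12.4, Thm. 12.5, Lemma 12.7
  (held: `book:cornellnd-arithmetic-geometry`, PDF pp. 189–191).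
* [GortzWedhorn2023] U. Görtz, T. Wedhorn, *Algebraic Geometry II* (2023): Thm. 24.73 (p. 550).

## Design

No definitions, no named facts; a one-line composition.
-/

universe u

open CategoryTheory CategoryTheory.Limits AlgebraicGeometry

noncomputable section

namespace Literature.NumberTheory.DiophantineGeometry

section AbelianVariety
open Literature.AlgebraicGeometry.Motives (AbelianVariety theoremOfCube_linEquiv)
open Literature.AlgebraicGeometry.Motives.AbelianVariety

variable {K : Type u} [Field K]

open Classical in
/-- **Mumford §19 Theorem 3 over an arbitrary field from the Theorem of the Cube and the two
geometric inputs over the algebraic closure.** If Poincaré's complete reducibility theorem (§19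
Thm. 1) and "simple ⇒ isogeny" (§19 Cor. 2 of Thm. 1) hold for abelian varieties over `K̄`, then
`Hom_K(A, B)` is finitely generated for all `A`, `B` over `K`: `Hom_K(A, B) ↪ Hom_K̄(A_K̄, B_K̄)`
(`module_finite_hom_of_baseChange`; Milne 1986, Thm. 12.5 is stated over an arbitrary field, Mumford
works over `k = k̄`). [cite: Milne1986AbelianVarieties, Thm. 12.5 (PDF p. 190)] -/
theorem _root_.Literature.AlgebraicGeometry.Motives.AbelianVariety.module_finite_hom_of_theoremOfCube_of_algebraicClosure
    (hcube : theoremOfCube_linEquiv.{u})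
    (hP1 : ∀ (X Y : AbelianVariety (AlgebraicClosure K)) (i : Y ⟶ X),
      IsClosedImmersion (Hom.toSchemeHom i) → 0 < Y.dim → Y.dim < X.dim →
      ∃ (Z : AbelianVariety (AlgebraicClosure K)) (j : Z ⟶ X),
        IsClosedImmersion (Hom.toSchemeHom j) ∧ IsIsogeny (biprod.desc i j))
    (hsimple : ∀ (X Y : AbelianVariety (AlgebraicClosure K)), IsSimple X → IsSimple Y →
      ∀ f : X ⟶ Y, f ≠ 0 → IsIsogeny f)
    (A B : AbelianVariety K) : module_finite_hom A B :=
  module_finite_hom_of_baseChange (A := A) (B := B) (AlgebraicClosure K)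
    (module_finite_hom_of_theoremOfCube_of_poincare hcube hP1 hsimple _ _)

end AbelianVariety

end Literature.NumberTheory.DiophantineGeometry
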